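import Summits.CriticalPhenomena.PercolationContinuityZ3.Theorems.Transplant.Slab111VHelix
import HarnessLib

/-!
# Paths in the `(111)`-films `F_k`, V: RIDES — the helix of a face between two levels, by absolute level, as a self-avoiding film path

builds on p205010 (kernel theorem, internal audit signed; external expert review pending) — NOT used in this file.  Lane `prim-bschramm`, seat
`prim-bschramm-p2` (gen 35; class C1b; memo `HOME/bschramm/P2-LATTICES.md` §129); helper file (`--supports stmt-CriticalPhenomena-4575 --as helper`).
In the routing certificate for `ShapedLinkage 3 (Slab111.hexShadow k)` every terminal is reached by a RIDE: the helix of a triangular face of `𝕋` between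
the level of a port of the rigid core and the level of the terminal.  A face is recorded by its three RELATIVE columns sorted by class
(`FaceD.f0/f1/f2`, classes `0/1/2`); the column of the face carrying the absolute level `L` over the block centre `z` (class `c0 = cls z`) is
`colAt F (L − c0)`, and consecutive levels are joined by an up-step of `U` (`FaceD.ok`: the class conditions and `f1 − f0, f2 − f1, f0 − f2 ∈ U`).
* §1 `FaceD`, `colAt`, `FaceD.ok`, `vcol z q = z + (q₁,q₂)`, the step lemma `colAt_succ`, admissibility `adm_rideV`, adjacency `adj_rideV`;
* §2 **`rideL k z c0 F L₀ n`** (the vertices at levels `L₀, …, L₀+n`), **`ride_gpath`**, `mem_rideL`, `sh_mem_of_mem_rideL`, `lev_of_mem_rideL`, `rideV_eq_of_sh_lev`.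
[cite: DuminilCopinSidoraviciusTassion2016, §2.3 (proof of Fact 2: the paths γ_u, γ_v, γ_w)] [cite: GrimmettPercolation1999, §1.6 p. 16]
-/

noncomputable section

namespace Summit.CriticalPhenomena.PercolationContinuityZ3.Theorems.Transplant

open Literature.Probability.Percolation Literature.Probability.LatticeModels SimpleGraph
open scoped Classical

namespace Slab111

variable {k : ℕ}

/-! ## §1 Faces as data -/

/-- A triangular face of `𝕋` in relative coordinates, columns sorted by class `0, 1, 2`. [folklore] -/
structure FaceD where
  /-- the column of class `0` -/
  f0 : ℤ × ℤ
  /-- the column of class `1` -/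
  f1 : ℤ × ℤ
  /-- the column of class `2` -/
  f2 : ℤ × ℤ
deriving DecidableEq, Repr

/-- The column of the face whose class is `m mod 3`. [folklore] -/
def colAt (F : FaceD) (m : ℤ) : ℤ × ℤ := if m % 3 = 0 then F.f0 else if m % 3 = 1 then F.f1 else F.f2

/-- The difference of two integer pairs is the up-step `u₁ = (1,0)`, `u₂ = (0,−1)` or `u₃ = (−1,1)`. [folklore] -/
def IsUp (p q : ℤ × ℤ) : Prop := (q.1 = p.1 + 1 ∧ q.2 = p.2) ∨ (q.1 = p.1 ∧ q.2 = p.2 - 1) ∨ (q.1 = p.1 - 1 ∧ q.2 = p.2 + 1)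

/-- `IsUp` is decidable. [folklore] -/
instance (p q : ℤ × ℤ) : Decidable (IsUp p q) := by unfold IsUp; infer_instance

/-- **Well-formed face data**: the three columns have classes `0, 1, 2` and consecutive classes are joined by up-steps (then the three columns are a
triangle of `𝕋` and its helix climbs `f0 → f1 → f2 → f0`). [folklore] -/
def FaceD.ok (F : FaceD) : Prop :=
  (3 : ℤ) ∣ F.f0.1 + 2 * F.f0.2 ∧ (3 : ℤ) ∣ F.f1.1 + 2 * F.f1.2 - 1 ∧ (3 : ℤ) ∣ F.f2.1 + 2 * F.f2.2 - 2 ∧ IsUp F.f0 F.f1 ∧ IsUp F.f1 F.f2 ∧ IsUp F.f2 F.f0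

/-- `FaceD.ok` is decidable. [folklore] -/
instance (F : FaceD) : Decidable F.ok := by unfold FaceD.ok; infer_instance

/-- The absolute column of a relative one. [folklore] -/
def vcol (z : Site 2) (q : ℤ × ℤ) : Site 2 := z + ![q.1, q.2]

/-- Coordinates of `vcol`. [folklore] -/
@[simp] theorem vcol_apply_zero (z : Site 2) (q : ℤ × ℤ) : vcol z q 0 = z 0 + q.1 := by simp [vcol]
/-- Coordinates of `vcol`. [folklore] -/
@[simp] theorem vcol_apply_one (z : Site 2) (q : ℤ × ℤ) : vcol z q 1 = z 1 + q.2 := by simp [vcol]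

/-- `vcol z` is injective. [folklore] -/
theorem vcol_injective (z : Site 2) : Function.Injective (vcol z) := by
  intro p q h
  have h0 := congrFun h 0; have h1 := congrFun h 1
  simp only [vcol_apply_zero, vcol_apply_one] at h0 h1
  ext <;> omega

/-- The class of `colAt F m` is `m mod 3`. [folklore] -/
theorem dvd_colAt {F : FaceD} (hF : F.ok) (m : ℤ) : (3 : ℤ) ∣ (colAt F m).1 + 2 * (colAt F m).2 - m := by
  obtain ⟨h0, h1, h2, -, -, -⟩ := hF
  have hm : m % 3 = 0 ∨ m % 3 = 1 ∨ m % 3 = 2 := by omega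
  have hdiv := Int.emod_emod_of_dvd m (dvd_refl (3 : ℤ))
  unfold colAt
  rcases hm with hm | hm | hm
  · simp only [hm]; norm_num; omega
  · simp only [hm]; norm_num; omega
  · simp only [hm]; norm_num; omega

/-- **Consecutive face columns differ by an up-step.** [folklore] -/
theorem isUp_colAt_succ {F : FaceD} (hF : F.ok) (m : ℤ) : IsUp (colAt F m) (colAt F (m + 1)) := by
  obtain ⟨-, -, -, h01, h12, h20⟩ := hF
  have hm : m % 3 = 0 ∨ m % 3 = 1 ∨ m % 3 = 2 := by omega
  unfold colAt
  rcases hm with hm | hm | hm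
  · have : (m + 1) % 3 = 1 := by omega
    simp only [hm, this]; exact h01
  · have : (m + 1) % 3 = 2 := by omega
    simp only [hm, this]; norm_num; exact h12
  · have : (m + 1) % 3 = 0 := by omega
    simp only [hm, this]; norm_num; exact h20

/-- The ride vertex at absolute level `L`: over the face column of class `L − c0`. [folklore] -/
def rideV (k : ℕ) (z : Site 2) (c0 : ℤ) (F : FaceD) (L : ℤ) : slab111 k := vl k (vcol z (colAt F (L - c0))) L

/-- Admissibility of a ride vertex inside `[0, k]` when `c0` is the class of `z`. [folklore] -/
theorem adm_rideV {z : Site 2} {c0 : ℤ} (hz : (3 : ℤ) ∣ z 0 + 2 * z 1 - c0) {F : FaceD} (hF : F.ok) {L : ℤ} (h0 : 0 ≤ L) (hk : L ≤ k) :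
    Adm k (vcol z (colAt F (L - c0))) L := by
  refine ⟨?_, h0, hk⟩
  have h := dvd_colAt hF (L - c0)
  simp only [lvl, vcol_apply_zero, vcol_apply_one]
  have e : L - (z 0 + (colAt F (L - c0)).1 + 2 * (z 1 + (colAt F (L - c0)).2)) =
      -(((colAt F (L - c0)).1 + 2 * (colAt F (L - c0)).2 - (L - c0)) + (z 0 + 2 * z 1 - c0)) := by ring
  rw [e, dvd_neg]; exact dvd_add h hz

/-- An up-step of relative columns is an up-step of absolute columns along `u₁`, `u₂` or `u₃`. [folklore] -/
theorem vcol_of_isUp {z : Site 2} {p q : ℤ × ℤ} (h : IsUp p q) : vcol z q = vcol z p + u₁ ∨ vcol z q = vcol z p + u₂ ∨ vcol z q = vcol z p + u₃ := by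
  rcases h with ⟨h1, h2⟩ | ⟨h1, h2⟩ | ⟨h1, h2⟩
  · left; ext i; fin_cases i
    · simp [h1]; ring
    · simp [h2]
  · right; left; ext i; fin_cases i
    · simp [h1]
    · simp [h2]; ring
  · right; right; ext i; fin_cases i
    · simp [h1]; ring
    · simp [h2]; ring

/-- **Consecutive ride vertices are adjacent.** [folklore] -/
theorem adj_rideV {z : Site 2} {c0 : ℤ} (hz : (3 : ℤ) ∣ z 0 + 2 * z 1 - c0) {F : FaceD} (hF : F.ok) {L : ℤ} (h0 : 0 ≤ L) (hk : L + 1 ≤ k) :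
    (film k).Adj (rideV k z c0 F L) (rideV k z c0 F (L + 1)) := by
  have hadm := adm_rideV (k := k) hz hF h0 (by omega)
  have hadm' := adm_rideV (k := k) hz hF (L := L + 1) (by omega) hk
  have hup := isUp_colAt_succ hF (L - c0)
  have e : L + 1 - c0 = L - c0 + 1 := by ring
  unfold rideV
  rw [e] at hadm' ⊢
  rcases vcol_of_isUp (z := z) hup with h | h | h <;> rw [h] at hadm' ⊢
  · exact adj_vl_u₁ hadm hadm'
  · exact adj_vl_u₂ hadm hadm'
  · exact adj_vl_u₃ hadm hadm'

/-! ## §2 Rides -/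

/-- **The ride on the face `F` through the levels `L₀, …, L₀ + n`.** [folklore] -/
def rideL (k : ℕ) (z : Site 2) (c0 : ℤ) (F : FaceD) (L₀ : ℤ) (n : ℕ) : List (slab111 k) :=
  (List.range (n + 1)).map fun i : ℕ => rideV k z c0 F (L₀ + (i : ℤ))

/-- Membership in a ride. [folklore] -/
theorem mem_rideL {z : Site 2} {c0 : ℤ} {F : FaceD} {L₀ : ℤ} {n : ℕ} {v : slab111 k} :
    v ∈ rideL k z c0 F L₀ n ↔ ∃ i : ℕ, i ≤ n ∧ v = rideV k z c0 F (L₀ + i) := by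
  unfold rideL
  rw [List.mem_map]
  constructor
  · rintro ⟨i, hi, rfl⟩
    rw [List.mem_range] at hi
    exact ⟨i, by omega, rfl⟩
  · rintro ⟨i, hi, rfl⟩
    exact ⟨i, List.mem_range.2 (by omega), rfl⟩

/-- The shadow of a ride vertex lies over a column of the face. [folklore] -/
theorem sh_rideV {z : Site 2} {c0 : ℤ} (hz : (3 : ℤ) ∣ z 0 + 2 * z 1 - c0) {F : FaceD} (hF : F.ok) {L : ℤ} (h0 : 0 ≤ L) (hk : L ≤ k) :
    sh (rideV k z c0 F L) = vcol z (colAt F (L - c0)) := sh_vl (adm_rideV hz hF h0 hk)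

/-- The level of a ride vertex. [folklore] -/
theorem lev_rideV {z : Site 2} {c0 : ℤ} (hz : (3 : ℤ) ∣ z 0 + 2 * z 1 - c0) {F : FaceD} (hF : F.ok) {L : ℤ} (h0 : 0 ≤ L) (hk : L ≤ k) :
    lev ((rideV k z c0 F L : slab111 k) : Site 3) = L := lev_vl (adm_rideV hz hF h0 hk)

/-- `colAt` takes one of the three face columns. [folklore] -/
theorem colAt_mem (F : FaceD) (m : ℤ) : colAt F m = F.f0 ∨ colAt F m = F.f1 ∨ colAt F m = F.f2 := by
  unfold colAt; split_ifs <;> simp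

/-- **A ride is a self-avoiding film path** from its lowest to its highest vertex. [cite: DuminilCopinSidoraviciusTassion2016, §2.3 (proof of Fact 2: γ_u, γ_v, γ_w)] -/
theorem ride_gpath {z : Site 2} {c0 : ℤ} (hz : (3 : ℤ) ∣ z 0 + 2 * z 1 - c0) {F : FaceD} (hF : F.ok) {L₀ : ℤ} (h0 : 0 ≤ L₀) {n : ℕ} (hk : L₀ + n ≤ k) :
    GPath (film k) (rideL k z c0 F L₀ n) (rideV k z c0 F L₀) (rideV k z c0 F (L₀ + n)) := by
  induction n with
  | zero => simpa [rideL] using GPath.single (film k) (rideV k z c0 F L₀)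
  | succ n ih =>
    have hn' : L₀ + n ≤ k := by push_cast at hk; omega
    have hprev := ih hn'
    have hstep : (film k).Adj (rideV k z c0 F (L₀ + n)) (rideV k z c0 F (L₀ + (n + 1 : ℕ))) := by
      have e : L₀ + ((n + 1 : ℕ) : ℤ) = L₀ + n + 1 := by push_cast; ring
      rw [e]; exact adj_rideV hz hF (by omega) (by push_cast at hk; omega)
    have hlist : rideL k z c0 F L₀ (n + 1) = rideL k z c0 F L₀ n ++ [rideV k z c0 F (L₀ + (n + 1 : ℕ))] := by
      simp [rideL, List.range_succ]
    rw [hlist]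
    have hnew : rideV k z c0 F (L₀ + (n + 1 : ℕ)) ∉ rideL k z c0 F L₀ n := by
      intro hmem
      obtain ⟨i, hi, heq⟩ := mem_rideL.1 hmem
      have h1 := lev_rideV (k := k) hz hF (L := L₀ + (n + 1 : ℕ)) (by omega) hk
      have h2 := lev_rideV (k := k) hz hF (L := L₀ + (i : ℕ)) (by omega) (by omega)
      rw [heq, h2] at h1
      push_cast at h1; omega
    have := hprev.trans (GPath.pair hstep) (fun v hv hvl => by
      rcases List.mem_cons.1 hv with rfl | hv
      · rfl
      · simp only [List.mem_singleton] at hv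
        exact absurd (hv ▸ hvl) hnew)
    simpa using this

/-- The shadow of a vertex of a ride lies over one of the three face columns. [folklore] -/
theorem sh_mem_of_mem_rideL {z : Site 2} {c0 : ℤ} (hz : (3 : ℤ) ∣ z 0 + 2 * z 1 - c0) {F : FaceD} (hF : F.ok) {L₀ : ℤ} (h0 : 0 ≤ L₀) {n : ℕ}
    (hk : L₀ + n ≤ k) {v : slab111 k} (hv : v ∈ rideL k z c0 F L₀ n) : sh v = vcol z F.f0 ∨ sh v = vcol z F.f1 ∨ sh v = vcol z F.f2 := by
  obtain ⟨i, hi, rfl⟩ := mem_rideL.1 hv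
  rw [sh_rideV hz hF (by omega) (by omega)]
  rcases colAt_mem F (L₀ + i - c0) with h | h | h
  · exact Or.inl (by rw [h])
  · exact Or.inr (Or.inl (by rw [h]))
  · exact Or.inr (Or.inr (by rw [h]))

/-- The level of a vertex of a ride lies in the ride's range. [folklore] -/
theorem lev_of_mem_rideL {z : Site 2} {c0 : ℤ} (hz : (3 : ℤ) ∣ z 0 + 2 * z 1 - c0) {F : FaceD} (hF : F.ok) {L₀ : ℤ} (h0 : 0 ≤ L₀) {n : ℕ}
    (hk : L₀ + n ≤ k) {v : slab111 k} (hv : v ∈ rideL k z c0 F L₀ n) : L₀ ≤ lev (v : Site 3) ∧ lev (v : Site 3) ≤ L₀ + n := by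
  obtain ⟨i, hi, rfl⟩ := mem_rideL.1 hv
  rw [lev_rideV hz hF (by omega) (by omega)]
  constructor <;> omega

/-- A vertex of a ride is the ride vertex of its own level. [folklore] -/
theorem eq_rideV_of_mem_rideL {z : Site 2} {c0 : ℤ} (hz : (3 : ℤ) ∣ z 0 + 2 * z 1 - c0) {F : FaceD} (hF : F.ok) {L₀ : ℤ} (h0 : 0 ≤ L₀) {n : ℕ}
    (hk : L₀ + n ≤ k) {v : slab111 k} (hv : v ∈ rideL k z c0 F L₀ n) : v = rideV k z c0 F (lev (v : Site 3)) := by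
  obtain ⟨i, hi, rfl⟩ := mem_rideL.1 hv
  rw [lev_rideV hz hF (by omega) (by omega)]

/-- **A film vertex over a face column at level `L` (class-consistent) IS the ride vertex of level `L`.** [folklore] -/
theorem rideV_eq_of_sh_lev {z : Site 2} {c0 : ℤ} (hz : (3 : ℤ) ∣ z 0 + 2 * z 1 - c0) {F : FaceD} (hF : F.ok) {L : ℤ} (h0 : 0 ≤ L) (hk : L ≤ k)
    {x : slab111 k} (hs : sh x = vcol z (colAt F (L - c0))) (hl : lev (x : Site 3) = L) : x = rideV k z c0 F L :=
  eq_of_sh_eq_of_lev_eq (by rw [hs, sh_rideV hz hF h0 hk]) (by rw [hl, lev_rideV hz hF h0 hk])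

/-- Every vertex of a ride lies in a set containing all class-consistent vertices over the face in the ride's level range. [folklore] -/
theorem rideL_subset {z : Site 2} {c0 : ℤ} {F : FaceD} {L₀ : ℤ} {n : ℕ} {S : Set (slab111 k)}
    (hS : ∀ L : ℤ, L₀ ≤ L → L ≤ L₀ + n → rideV k z c0 F L ∈ S) : ∀ v ∈ rideL k z c0 F L₀ n, v ∈ S := by
  intro v hv
  obtain ⟨i, hi, rfl⟩ := mem_rideL.1 hv
  exact hS _ (by omega) (by omega)

end Slab111

end Summit.CriticalPhenomena.PercolationContinuityZ3.Theorems.Transplant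

end
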